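import Literature.Analysis.FluidPDE.NSBoundedCaloricDuality
import Literature.Analysis.FluidPDE.CaloricDualityTerms
import Literature.Analysis.FluidPDE.NSBoundedInteriorRegularity
import Mathlib.Analysis.Distribution.AEEqOfIntegralContDiff
import HarnessLib

/-!
# Proof of `NSBoundedInteriorContinuity` (Seregin–Šverák 2009, §2)

Analysis/FluidPDE file discharging the named fact
`Literature.Analysis.FluidPDE.NSBoundedInteriorContinuity` of `NSBoundedInteriorRegularity.lean`
(`theorem NSBoundedInteriorContinuity_holds`): an essentially bounded distributional solution
`(u, p)` of the Navier–Stokes system (`ν = 1`, no force) in a parabolic cylinder `Q(z, R)`, with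
`p ∈ L_{3/2}(Q(z, R))`, agrees a.e. with a function continuous on the open cylinder
(Seregin–Šverák 2009, §2, arXiv p. 8, "our solution `v` and `q` has good properties inside `Q₁`").

## The argument (caloric duality)

The printed mechanism ("local regularity theory", [ESS4], [LS], [NRS]: Serrin-type bootstrap) is
replaced by a direct duality argument using only the tree's caloric calculus; no step is specific
to dimension three except the truncated Newtonian potential `Γ₀ = newtonNear 1 2`.

1. *Localisation.* Around `w ∈ Q(z, R)` fix a centred cylinder `Q*_ρ(w) ⊆ Q(z, R)` and the
  product cut-off `φ(t, x) = χ(t - t_w) θ(x - x_w)` (`radialCutoff`s), `φ ∈ C_c^∞(Q*_ρ(w))`,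
  `φ = 1` on `Q*_{ρ/2}`-type neighbourhoods of `w` and *locally constant in space* on
  `{‖x - x_w‖ < ρ/2}`, so that every spatial derivative of `φ` is supported in the annulus
  `A = {ρ/2 ≤ ‖x - x_w‖}`, at distance `ρ/4` from the ball `B(x_w, ρ/4)`.
2. *The master identity* (`NSBoundedCaloricDuality.integral_cutoff_mul_test_mul_inner_eq`): for a
  scalar test function `g̃` supported in `V = Q*_{ρ/4}(w)` and a unit vector `c`,
  `∫ g̃ ⟪u, c⟫ = Σ_k ∫_Q T_k m_k X_k(g̃)`, where `T_k` is a derivative of `φ`, `m_k ∈ {u_c, uᵢu_c,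
  uᵢuⱼ, p}` and `X_k(g̃) = (K_k ⋆ g̃)` is a caloric field with an explicit backward kernel `K_k`
  (`CaloricDuhamelRepresentation`): the heat kernel and its gradient, `heatD1/heatD3` of `Γ₀`
  (slice-bound kernels, `CaloricKernelFamilies`), and `heatD2` of `Γ₀`, `heatD1` of the smoothing
  remainder `λ` (kernels bounded off the diagonal) — the latter only ever paired with data
  supported in the annulus `A` (this is what the local constancy of `φ` buys).
3. *Duality* (`CaloricDualityTerms`): `∫ (T_k m_k) (K_k ⋆ g̃) = ∫ g̃ (Ǩ_k ⋆ (T_k m_k))`, and the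
  potential `W_k = Ǩ_k ⋆ (T_k m_k)` is continuous (everywhere for slice-bound kernels and bounded
  data — this is where `u ∈ L^∞` enters — and on `{‖x - x_w‖ < ρ/4}` for the off-diagonal ones,
  whose data `p`, `p ∂φ`, `uᵢuⱼ ∂φ` are merely integrable). Hence `∫ g̃ ⟪u, c⟫ = ∫ g̃ W` with
  `W = Σ_k W_k` continuous near `w`, for all `g̃ ∈ C_c^∞(V)`.
4. *Conclusion.* By du Bois-Reymond (`IsOpen.ae_eq_zero_of_integral_contDiff_smul_eq_zero`)
  `⟪u, c⟫ = W` a.e. on `V`; with `c` running through the standard basis, `u` is a.e. equal on `V`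
  to a continuous field, and the local representatives glue
  (`exists_continuousOn_ae_eq_of_locally`).

Everything here is proved. The pressure hypothesis `p ∈ L_{3/2}` of the fact is not needed beyond
the local integrability contained in `IsDistributionalNSSolutionOn`.

## References

* G. Seregin, V. Šverák, *On Type I singularities of the local axi-symmetric solutions of the
  Navier–Stokes equations*, Comm. PDE 34 (2009) = arXiv:0804.1803, §2 (p. 8). [`SereginSverak2009`]
* P. G. Lemarié-Rieusset, *The Navier–Stokes Problem in the 21st Century* (2016), §13.4, (13.19).
-/

noncomputable section

open MeasureTheory Set Function Filter TopologicalSpace Metric ContinuousLinearMap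
open scoped Topology RealInnerProductSpace Laplacian ENNReal Convolution

namespace Literature.Analysis.FluidPDE

/-! ### Generic data lemmas on `ℝ × E` -/

section Topological

variable {X : Type*} [TopologicalSpace X]

/-- A continuous function vanishing off a compact set is bounded. [folklore] -/
theorem exists_abs_le_of_eq_zero_off_compact {K : Set X} (hK : IsCompact K) {T : X → ℝ}
    (hT : Continuous T) (hT0 : ∀ z, z ∉ K → T z = 0) : ∃ B : ℝ, 0 ≤ B ∧ ∀ z, |T z| ≤ B := by
  obtain ⟨B, hB⟩ := hK.exists_bound_of_continuousOn hT.continuousOn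
  refine ⟨max B 0, le_max_right _ _, fun z => ?_⟩
  by_cases hz : z ∈ K
  · exact ((Real.norm_eq_abs _).symm.le.trans (hB z hz)).trans (le_max_left _ _)
  · rw [hT0 z hz, abs_zero]; exact le_max_right _ _

end Topological

section Data

variable {E : Type*} [NormedAddCommGroup E] [InnerProductSpace ℝ E] [FiniteDimensional ℝ E]
  [MeasurableSpace E] [BorelSpace E]

/-- `T · m` is integrable when `T` is continuous and vanishes off a compact `K` on which `m` is
integrable. [folklore] -/
theorem integrable_test_mul {K : Set (ℝ × E)} (hK : IsCompact K)
    {T m : ℝ × E → ℝ} (hT : Continuous T) (hT0 : ∀ z, z ∉ K → T z = 0)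
    (hm : IntegrableOn m K volume) : Integrable (fun z => T z * m z) volume := by
  obtain ⟨B, -, hB⟩ := exists_abs_le_of_eq_zero_off_compact hK hT hT0
  have hKi : IntegrableOn (fun z => T z * m z) K volume :=
    hm.bdd_mul (c := B) hT.aestronglyMeasurable
      (Eventually.of_forall fun z => by rw [Real.norm_eq_abs]; exact hB z)
  exact hKi.integrable_of_forall_notMem_eq_zero fun z hz => by rw [hT0 z hz, zero_mul]

/-- A test function times a function continuous on an open set containing its support is
integrable. [folklore] -/
theorem integrable_test_mul_of_continuousOn {g W : ℝ × E → ℝ} (hg : Continuous g)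
    (hgc : HasCompactSupport g) {U : Set (ℝ × E)} (hgU : tsupport g ⊆ U) (hU : IsOpen U)
    (hW : ContinuousOn W U) : Integrable (fun z => g z * W z) volume := by
  have hc : Continuous fun z => g z * W z := by
    refine continuous_iff_continuousAt.2 fun z => ?_
    by_cases hz : z ∈ tsupport g
    · exact hg.continuousAt.mul (hW.continuousAt (hU.mem_nhds (hgU hz)))
    · have h0 : g =ᶠ[𝓝 z] 0 := notMem_tsupport_iff_eventuallyEq.1 hz
      have h1 : (fun z => g z * W z) =ᶠ[𝓝 z] fun _ => 0 :=
        h0.mono fun y hy => by simp only [hy, Pi.zero_apply, zero_mul]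
      exact (continuousAt_const.congr h1.symm)
  exact hc.integrable_of_hasCompactSupport (hgc.mul_right)

/-- **Slice-bound data.** For `T` continuous vanishing off a compact `K ⊆ Q` with `Q` of bounded
time extent, and `m` integrable on `K` and essentially bounded on `Q`: `T · m` is integrable,
essentially bounded, and has bounded time support. [folklore] -/
theorem sliceBound_data {K Q : Set (ℝ × E)} (hKc : IsCompact K) (hKQ : K ⊆ Q) (hQ : MeasurableSet Q)
    {a b : ℝ} (hQab : ∀ z ∈ Q, z.1 ∈ Icc a b) {T m : ℝ × E → ℝ} (hT : Continuous T)
    (hT0 : ∀ z, z ∉ K → T z = 0) (hmK : IntegrableOn m K volume) {Mm : ℝ} (hMm : 0 ≤ Mm)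
    (hm : ∀ᵐ z ∂(volume.restrict Q), |m z| ≤ Mm) :
    ∃ B : ℝ, 0 ≤ B ∧ Integrable (fun z => T z * m z) volume ∧
      (∀ᵐ z ∂(volume : Measure (ℝ × E)), |T z * m z| ≤ B) ∧
      (∀ᵐ z ∂(volume : Measure (ℝ × E)), T z * m z ≠ 0 → z.1 ∈ Icc a b) := by
  obtain ⟨B, hB0, hB⟩ := exists_abs_le_of_eq_zero_off_compact hKc hT hT0
  refine ⟨B * Mm, mul_nonneg hB0 hMm, integrable_test_mul hKc hT hT0 hmK, ?_,
    Eventually.of_forall fun z hz => ?_⟩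
  · have hm' := (ae_restrict_iff' hQ).1 hm
    filter_upwards [hm'] with z hz
    by_cases hzK : z ∈ K
    · rw [abs_mul]
      exact mul_le_mul (hB z) (hz (hKQ hzK)) (abs_nonneg _) hB0
    · rw [hT0 z hzK, zero_mul, abs_zero]; positivity
  · have hzK : z ∈ K := by
      by_contra h
      exact hz (by rw [hT0 z h, zero_mul])
    exact hQab z (hKQ hzK)

/-- **Off-diagonal data.** For `T` continuous vanishing off a compact `K` and outside `ℝ × A`, and
`m` integrable on `K`: `T · m` is integrable and supported in `ℝ × A`. [folklore] -/
theorem offDiag_data {K : Set (ℝ × E)} (hKc : IsCompact K) {T m : ℝ × E → ℝ}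
    (hT : Continuous T) (hT0 : ∀ z, z ∉ K → T z = 0) {A : Set E} (hTA : ∀ z, T z ≠ 0 → z.2 ∈ A)
    (hmK : IntegrableOn m K volume) :
    Integrable (fun z => T z * m z) volume ∧
      ∀ᵐ z ∂(volume : Measure (ℝ × E)), T z * m z ≠ 0 → z.2 ∈ A :=
  ⟨integrable_test_mul hKc hT hT0 hmK,
    Eventually.of_forall fun z hz => hTA z fun h => hz (by rw [h, zero_mul])⟩

/-! ### The four term lemmas -/

/-- **Continuity of a slice-bound potential of cut-off data.** [folklore] -/
theorem continuous_potential_sliceBound {κ : ℝ → E → ℝ} {N : ℝ → ℝ}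
    (hK : IsSliceBoundKernel (backKernel κ) N) {K Q : Set (ℝ × E)} (hKc : IsCompact K) (hKQ : K ⊆ Q)
    (hQ : MeasurableSet Q) {a b : ℝ} (hQab : ∀ z ∈ Q, z.1 ∈ Icc a b) {T m : ℝ × E → ℝ}
    (hT : Continuous T) (hT0 : ∀ z, z ∉ K → T z = 0) (hmK : IntegrableOn m K volume) {Mm : ℝ}
    (hMm : 0 ≤ Mm) (hm : ∀ᵐ z ∂(volume.restrict Q), |m z| ≤ Mm) :
    Continuous ((fun v => backKernel κ (-v)) ⋆[lsmul ℝ ℝ, (volume : Measure (ℝ × E))]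
      (fun z => T z * m z)) := by
  obtain ⟨B, hB0, hfi, hfB, hfsupp⟩ := sliceBound_data hKc hKQ hQ hQab hT hT0 hmK hMm hm
  exact hK.reflect.continuous_convolution hfi hB0 hfB hfsupp

/-- **Duality for a slice-bound term**: `∫_Q T m X = ∫ g̃ (Ǩ ⋆ (T m))` when `X = K ⋆ g̃` on `K`.
[folklore] -/
theorem setIntegral_eq_integral_mul_potential_sliceBound {κ : ℝ → E → ℝ} {N : ℝ → ℝ}
    (hK : IsSliceBoundKernel (backKernel κ) N) {g : ℝ × E → ℝ}
    (hg : IsSpaceTimeTestOn (⊤ : Opens (ℝ × E)) fun t x => g (t, x)) {K Q : Set (ℝ × E)}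
    (hKc : IsCompact K) (hKQ : K ⊆ Q) (hQ : MeasurableSet Q) {a b : ℝ}
    (hQab : ∀ z ∈ Q, z.1 ∈ Icc a b) {T m X : ℝ × E → ℝ} (hT : Continuous T)
    (hT0 : ∀ z, z ∉ K → T z = 0) (hmK : IntegrableOn m K volume) {Mm : ℝ} (hMm : 0 ≤ Mm)
    (hm : ∀ᵐ z ∂(volume.restrict Q), |m z| ≤ Mm)
    (hX : ∀ z ∈ K, X z = (backKernel κ ⋆[lsmul ℝ ℝ, (volume : Measure (ℝ × E))] g) z) :
    ∫ z in Q, T z * m z * X z =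
      ∫ z, g z * ((fun v => backKernel κ (-v)) ⋆[lsmul ℝ ℝ, (volume : Measure (ℝ × E))]
        (fun z => T z * m z)) z := by
  obtain ⟨B, hB0, hfi, hfB, hfsupp⟩ := sliceBound_data hKc hKQ hQ hQab hT hT0 hmK hMm hm
  have hX' : ∀ z, T z * m z ≠ 0 →
      X z = (backKernel κ ⋆[lsmul ℝ ℝ, (volume : Measure (ℝ × E))] uncurry fun t x => g (t, x)) z :=
    fun z hz => by
    have hzK : z ∈ K := by
      by_contra h
      exact hz (by rw [hT0 z h, zero_mul])
    exact hX z hzK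
  have h := (duality_term_sliceBound hK hg hX' hfi hB0 hfB hfsupp).1
  rw [setIntegral_eq_integral_of_forall_compl_eq_zero fun z hz => by
    rw [hT0 z fun h => hz (hKQ h), zero_mul, zero_mul]]
  exact h

/-- **Continuity of an off-diagonal potential of annular data** on the set `U` of points
`δ`-separated from `A`. [folklore] -/
theorem continuousOn_potential_offDiag {κ : ℝ → E → ℝ} {δ : ℝ}
    (hK : IsOffDiagKernel (backKernel κ) {y | δ ≤ ‖y‖}) {K : Set (ℝ × E)} (hKc : IsCompact K)
    {T m : ℝ × E → ℝ} (hT : Continuous T) (hT0 : ∀ z, z ∉ K → T z = 0) {A : Set E}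
    (hTA : ∀ z, T z ≠ 0 → z.2 ∈ A) (hmK : IntegrableOn m K volume) {U : Set (ℝ × E)}
    (hU : IsOpen U) (hUA : ∀ z ∈ U, ∀ a ∈ A, δ ≤ ‖z.2 - a‖) :
    ContinuousOn ((fun v => backKernel κ (-v)) ⋆[lsmul ℝ ℝ, (volume : Measure (ℝ × E))]
      (fun z => T z * m z)) U := by
  obtain ⟨hfi, hfA⟩ := offDiag_data hKc hT hT0 hTA hmK
  have hD : ∀ y ∈ {y : E | δ ≤ ‖y‖}, -y ∈ {y : E | δ ≤ ‖y‖} := fun y hy => by simpa using hy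
  exact (hK.reflect hD).continuousOn_convolution hfi hfA hU fun z hz a ha => hUA z hz a ha

/-- **Duality for an off-diagonal term**: `∫_Q T m X = ∫ g̃ (Ǩ ⋆ (T m))` when `X = K ⋆ g̃` at the
points of `K` that are `δ`-separated from the spatial support of `g̃`. [folklore] -/
theorem setIntegral_eq_integral_mul_potential_offDiag {κ : ℝ → E → ℝ} {δ : ℝ}
    (hK : IsOffDiagKernel (backKernel κ) {y | δ ≤ ‖y‖}) {g : ℝ × E → ℝ}
    (hg : IsSpaceTimeTestOn (⊤ : Opens (ℝ × E)) fun t x => g (t, x)) {A Ag : Set E}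
    (hgA : ∀ z, g z ≠ 0 → z.2 ∈ Ag) (hsep : ∀ a ∈ A, ∀ a' ∈ Ag, δ ≤ ‖a - a'‖)
    {K Q : Set (ℝ × E)} (hKc : IsCompact K) (hKQ : K ⊆ Q) {T m X : ℝ × E → ℝ} (hT : Continuous T)
    (hT0 : ∀ z, z ∉ K → T z = 0) (hTA : ∀ z, T z ≠ 0 → z.2 ∈ A) (hmK : IntegrableOn m K volume)
    (hX : ∀ z ∈ K, (∀ a' ∈ Ag, δ ≤ ‖z.2 - a'‖) →
      X z = (backKernel κ ⋆[lsmul ℝ ℝ, (volume : Measure (ℝ × E))] g) z) :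
    ∫ z in Q, T z * m z * X z =
      ∫ z, g z * ((fun v => backKernel κ (-v)) ⋆[lsmul ℝ ℝ, (volume : Measure (ℝ × E))]
        (fun z => T z * m z)) z := by
  obtain ⟨hfi, hfA⟩ := offDiag_data hKc hT hT0 hTA hmK
  have hX' : ∀ z, T z * m z ≠ 0 →
      X z = (backKernel κ ⋆[lsmul ℝ ℝ, (volume : Measure (ℝ × E))] uncurry fun t x => g (t, x)) z :=
    fun z hz => by
    have hTz : T z ≠ 0 := fun h => hz (by rw [h, zero_mul])
    have hzK : z ∈ K := by
      by_contra h
      exact hTz (hT0 z h)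
    exact hX z hzK fun a' ha' => hsep z.2 (hTA z hTz) a' ha'
  -- the continuity clause of `duality_term_offDiag` is not used here: feed it `U = ∅`
  have h := (duality_term_offDiag hK hg (fun t y hy => hgA (t, y) hy) hsep hX' hfi hfA
    isOpen_empty (U := ∅) fun z hz _ _ => (Set.notMem_empty z hz).elim).1
  rw [setIntegral_eq_integral_of_forall_compl_eq_zero fun z hz => by
    rw [hT0 z fun h => hz (hKQ h), zero_mul, zero_mul]]
  exact h

end Data


/-! ### The cut-off adapted to a centred cylinder -/

section Cutoff

variable {E : Type*} [NormedAddCommGroup E] [InnerProductSpace ℝ E] [FiniteDimensional ℝ E]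
  [MeasurableSpace E] [BorelSpace E]

omit [MeasurableSpace E] [BorelSpace E] in
/-- **The product cut-off** `φ(t, x) = χ(t - t_w) θ(x - x_w)` with
`χ = radialCutoff (ρ²/4) (ρ²/2)` and `θ = radialCutoff (ρ/2) (3ρ/4)` is a space–time test function
on the centred cylinder `Q*_ρ(w)`. [folklore] -/
theorem isSpaceTimeTestOn_parabolicCutoff {ρ : ℝ} (hρ : 0 < ρ) (w : ℝ × E) :
    IsSpaceTimeTestOn (parabolicCylinderCenteredOpens ρ w) fun t x =>
      radialCutoff (ρ ^ 2 / 4) (ρ ^ 2 / 2) (t - w.1) * radialCutoff (ρ / 2) (3 * ρ / 4) (x - w.2) := by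
  have h₀t : (0 : ℝ) ≤ ρ ^ 2 / 4 := by positivity
  have h₁t : ρ ^ 2 / 4 < ρ ^ 2 / 2 := by nlinarith
  have h₀x : (0 : ℝ) ≤ ρ / 2 := by positivity
  have h₁x : ρ / 2 < 3 * ρ / 4 := by linarith
  set K₀ : Set (ℝ × E) := Icc (w.1 - ρ ^ 2 / 2) (w.1 + ρ ^ 2 / 2) ×ˢ closedBall w.2 (3 * ρ / 4)
    with hK₀_def
  have hK₀ : IsCompact K₀ := isCompact_Icc.prod (isCompact_closedBall _ _)
  have hf : (uncurry fun t x => radialCutoff (ρ ^ 2 / 4) (ρ ^ 2 / 2) (t - w.1) *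
      radialCutoff (ρ / 2) (3 * ρ / 4) (x - w.2)) = fun z : ℝ × E =>
      radialCutoff (ρ ^ 2 / 4) (ρ ^ 2 / 2) (z.1 - w.1) * radialCutoff (ρ / 2) (3 * ρ / 4) (z.2 - w.2) :=
    rfl
  have hzero : ∀ z : ℝ × E, z ∉ K₀ → radialCutoff (ρ ^ 2 / 4) (ρ ^ 2 / 2) (z.1 - w.1) *
      radialCutoff (ρ / 2) (3 * ρ / 4) (z.2 - w.2) = 0 := by
    intro z hz
    rw [hK₀_def, Set.mem_prod, not_and_or] at hz
    rcases hz with h | h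
    · have hz' : ρ ^ 2 / 2 ≤ ‖z.1 - w.1‖ := by
        rw [Real.norm_eq_abs]
        rw [mem_Icc, not_and_or, not_le, not_le] at h
        rcases h with h | h
        · rw [abs_of_neg (by linarith)]; linarith
        · rw [abs_of_pos (by linarith)]; linarith
      rw [radialCutoff_eq_zero h₀t h₁t hz', zero_mul]
    · have hz' : 3 * ρ / 4 ≤ ‖z.2 - w.2‖ := by
        rw [mem_closedBall, dist_eq_norm, not_le] at h
        exact h.le
      rw [radialCutoff_eq_zero h₀x h₁x hz', mul_zero]
  have hK₀Q : K₀ ⊆ parabolicCylinderCentered ρ w := by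
    rintro z ⟨hz1, hz2⟩
    rw [mem_Icc] at hz1
    rw [mem_closedBall] at hz2
    rw [mem_parabolicCylinderCentered]
    have hρ2 : ρ ^ 2 / 2 < ρ ^ 2 := by nlinarith
    exact ⟨⟨by linarith, by linarith⟩, by linarith⟩
  refine ⟨?_, ?_, ?_⟩
  · rw [hf]
    exact ((radialCutoff_contDiff _ _).comp (contDiff_fst.sub contDiff_const)).mul
      ((radialCutoff_contDiff _ _).comp (contDiff_snd.sub contDiff_const))
  · rw [hf]
    exact HasCompactSupport.intro hK₀ hzero
  · rw [hf]
    refine (closure_minimal (fun z hz => ?_) (isClosed_Icc.prod isClosed_closedBall)).trans hK₀Q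
    by_contra h
    exact hz (hzero z h)

omit [MeasurableSpace E] [BorelSpace E] [InnerProductSpace ℝ E] [FiniteDimensional ℝ E] in
/-- The product cut-off equals `1` for `|t - t_w| ≤ ρ²/4`, `‖x - x_w‖ ≤ ρ/2`. [folklore] -/
theorem parabolicCutoff_eq_one {ρ : ℝ} (hρ : 0 < ρ) (w : ℝ × E) {t : ℝ} {x : E}
    (ht : |t - w.1| ≤ ρ ^ 2 / 4) (hx : ‖x - w.2‖ ≤ ρ / 2) :
    radialCutoff (ρ ^ 2 / 4) (ρ ^ 2 / 2) (t - w.1) * radialCutoff (ρ / 2) (3 * ρ / 4) (x - w.2) = 1 := by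
  have ht' : ‖t - w.1‖ ≤ ρ ^ 2 / 4 := by rwa [Real.norm_eq_abs]
  rw [radialCutoff_eq_one (by positivity) (by nlinarith) ht',
    radialCutoff_eq_one (by positivity) (by linarith) hx, one_mul]

omit [MeasurableSpace E] [BorelSpace E] [InnerProductSpace ℝ E] [FiniteDimensional ℝ E] in
/-- The product cut-off is locally constant in space on `{‖x - x_w‖ < ρ/2}`. [folklore] -/
theorem parabolicCutoff_eventuallyEq {ρ : ℝ} (hρ : 0 < ρ) (w : ℝ × E) (t : ℝ) {x : E}
    (hx : ‖x - w.2‖ < ρ / 2) :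
    (fun y => radialCutoff (ρ ^ 2 / 4) (ρ ^ 2 / 2) (t - w.1) * radialCutoff (ρ / 2) (3 * ρ / 4) (y - w.2))
      =ᶠ[𝓝 x] fun _ => radialCutoff (ρ ^ 2 / 4) (ρ ^ 2 / 2) (t - w.1) := by
  have h1 : ∀ᶠ y in 𝓝 x, ‖y - w.2‖ < ρ / 2 :=
    (isOpen_lt (continuous_id.sub continuous_const).norm continuous_const).mem_nhds hx
  filter_upwards [h1] with y hy
  rw [radialCutoff_eq_one (by positivity) (by linarith) hy.le, mul_one]

omit [MeasurableSpace E] [BorelSpace E] [FiniteDimensional ℝ E] in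
/-- A function locally constant at `x` has zero derivative there. [folklore] -/
theorem fderiv_eq_zero_of_eventuallyEq_const {f : E → ℝ} {x : E} {a : ℝ}
    (h : f =ᶠ[𝓝 x] fun _ => a) : fderiv ℝ f x = 0 := by
  rw [h.fderiv_eq]; simp

omit [MeasurableSpace E] [BorelSpace E] in
/-- A function locally constant at `x` has zero Laplacian there. [folklore] -/
theorem laplacian_eq_zero_of_eventuallyEq_const {f : E → ℝ} {x : E} {a : ℝ}
    (h : f =ᶠ[𝓝 x] fun _ => a) : (Δ f) x = 0 := by
  rw [(InnerProductSpace.laplacian_congr_nhds h).self_of_nhds, InnerProductSpace.laplacian_const,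
    Pi.zero_apply]

end Cutoff

/-! ### The local representation `∫ g̃ ⟪u, c⟫ = ∫ g̃ W` -/

section Local

/-- **Local duality representation.** Let `(u, p)` be a distributional Navier–Stokes solution
(`ν = 1`, no force) in `Q*_ρ(w)` with `|u| ≤ M` a.e., and `‖c‖ ≤ 1`. There is a function `W`,
continuous on `{‖x - x_w‖ < ρ/4}`, with `∫ g̃ ⟪u, c⟫ = ∫ g̃ W` for every test function `g̃`
supported in `Q*_{ρ/4}(w)` (steps 1–3 of the module docstring).
[cite: SereginSverak2009, §2 p. 8; mechanism LemarieRieusset2016 (13.19)] -/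
theorem exists_continuousOn_forall_integral_mul_inner_eq {ρ : ℝ} {w : ℝ × (EuclideanSpace ℝ (Fin 3))}
    {u : ℝ → (EuclideanSpace ℝ (Fin 3)) → (EuclideanSpace ℝ (Fin 3))} {p : ℝ → (EuclideanSpace ℝ (Fin 3)) → ℝ} {M : ℝ} (hρ : 0 < ρ)
    (hsol : IsDistributionalNSSolutionOn (parabolicCylinderCenteredOpens ρ w) 1 0 u p) (hM : 0 ≤ M)
    (hbd : ∀ᵐ y ∂(volume.restrict (parabolicCylinderCentered ρ w)), ‖u y.1 y.2‖ ≤ M)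
    {c : (EuclideanSpace ℝ (Fin 3))} (hc : ‖c‖ ≤ 1) :
    ∃ W : ℝ × (EuclideanSpace ℝ (Fin 3)) → ℝ, ContinuousOn W {z | ‖z.2 - w.2‖ < ρ / 4} ∧
      ∀ g : ℝ × (EuclideanSpace ℝ (Fin 3)) → ℝ, ContDiff ℝ ((⊤ : ℕ∞) : WithTop ℕ∞) g → HasCompactSupport g →
        tsupport g ⊆ parabolicCylinderCentered (ρ / 4) w →
        ∫ z, g z * ⟪u z.1 z.2, c⟫ = ∫ z, g z * W z := by
  classical
  /- ### the cut-off -/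
  set φ : ℝ → (EuclideanSpace ℝ (Fin 3)) → ℝ := fun t x =>
    radialCutoff (ρ ^ 2 / 4) (ρ ^ 2 / 2) (t - w.1) * radialCutoff (ρ / 2) (3 * ρ / 4) (x - w.2)
    with hφ_def
  have hφ : IsSpaceTimeTestOn (parabolicCylinderCenteredOpens ρ w) φ :=
    isSpaceTimeTestOn_parabolicCutoff hρ w
  have hφ1 : ∀ z : ℝ × (EuclideanSpace ℝ (Fin 3)), |z.1 - w.1| ≤ ρ ^ 2 / 4 → ‖z.2 - w.2‖ ≤ ρ / 2 → φ z.1 z.2 = 1 :=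
    fun z ht hx => parabolicCutoff_eq_one hρ w ht hx
  have hφloc : ∀ (t : ℝ) (x : (EuclideanSpace ℝ (Fin 3))), ‖x - w.2‖ < ρ / 2 → φ t =ᶠ[𝓝 x] fun _ => φ t x := by
    intro t x hx
    have h := parabolicCutoff_eventuallyEq hρ w t hx
    have hx1 : φ t x = radialCutoff (ρ ^ 2 / 4) (ρ ^ 2 / 2) (t - w.1) := by
      simp only [hφ_def]
      rw [radialCutoff_eq_one (by positivity) (by linarith) hx.le, mul_one]
    rw [hx1]
    exact h
  have hQm : MeasurableSet (parabolicCylinderCentered ρ w) :=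
    (isOpen_parabolicCylinderCentered ρ w).measurableSet
  set K : Set (ℝ × (EuclideanSpace ℝ (Fin 3))) := tsupport (uncurry φ) with hK_def
  have hK : IsCompact K := hφ.hasCompactSupport
  have hKQ : K ⊆ parabolicCylinderCentered ρ w := hφ.tsupport_subset
  have hKQ' : K ⊆ ((parabolicCylinderCenteredOpens ρ w : Opens (ℝ × (EuclideanSpace ℝ (Fin 3)))) : Set (ℝ × (EuclideanSpace ℝ (Fin 3)))) :=
    hφ.tsupport_subset
  have hQab : ∀ z ∈ parabolicCylinderCentered ρ w, z.1 ∈ Icc (w.1 - ρ ^ 2) (w.1 + ρ ^ 2) :=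
    fun z hz => by
    rw [mem_parabolicCylinderCentered] at hz
    exact ⟨hz.1.1.le, hz.1.2.le⟩
  /- ### the basis and the data -/
  set e : OrthonormalBasis (Fin 3) ℝ (EuclideanSpace ℝ (Fin 3)) := EuclideanSpace.basisFun (Fin 3) ℝ with he_def
  have he1 : ∀ i, ‖e i‖ ≤ 1 := fun i => (e.orthonormal.1 i).le
  have hu := hsol.1
  have hu2 := hsol.2.1
  have hp := hsol.2.2.1
  have bm1 : ∀ a : (EuclideanSpace ℝ (Fin 3)), ‖a‖ ≤ 1 → ∀ᵐ z ∂(volume.restrict (parabolicCylinderCentered ρ w)), |⟪u z.1 z.2, a⟫| ≤ M := by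
    intro a ha
    filter_upwards [hbd] with z hz
    calc |⟪u z.1 z.2, a⟫| ≤ ‖u z.1 z.2‖ * ‖a‖ := abs_real_inner_le_norm _ _
      _ ≤ M * 1 := mul_le_mul hz ha (norm_nonneg _) hM
      _ = M := mul_one M
  have bm2 : ∀ a a' : (EuclideanSpace ℝ (Fin 3)), ‖a‖ ≤ 1 → ‖a'‖ ≤ 1 →
      ∀ᵐ z ∂(volume.restrict (parabolicCylinderCentered ρ w)), |⟪u z.1 z.2, a⟫ * ⟪u z.1 z.2, a'⟫| ≤ M ^ 2 := by
    intro a a' ha ha'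
    filter_upwards [bm1 a ha, bm1 a' ha'] with z h1 h2
    rw [abs_mul, sq]
    exact mul_le_mul h1 h2 (abs_nonneg _) hM
  have hM2 : 0 ≤ M ^ 2 := sq_nonneg M
  have mu : ∀ a : (EuclideanSpace ℝ (Fin 3)), IntegrableOn (fun z : ℝ × (EuclideanSpace ℝ (Fin 3)) => ⟪u z.1 z.2, a⟫) K volume := fun a =>
    integrableOn_inner_of_locallyIntegrableOn hK hKQ' hu a
  have muu : ∀ a a' : (EuclideanSpace ℝ (Fin 3)),
      IntegrableOn (fun z : ℝ × (EuclideanSpace ℝ (Fin 3)) => ⟪u z.1 z.2, a⟫ * ⟪u z.1 z.2, a'⟫) K volume := fun a a' =>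
    integrableOn_inner_mul_inner_of_locallyIntegrableOn hK hKQ' hu hu2 a a'
  have mp : IntegrableOn (fun z : ℝ × (EuclideanSpace ℝ (Fin 3)) => p z.1 z.2) K volume := hp.integrableOn_compact_subset hKQ' hK
  /- ### continuity and vanishing of the cut-off factors -/
  have cφ : Continuous fun z : ℝ × (EuclideanSpace ℝ (Fin 3)) => φ z.1 z.2 := hφ.contDiff.continuous
  have cφt : Continuous fun z : ℝ × (EuclideanSpace ℝ (Fin 3)) => timeDeriv φ z.1 z.2 := hφ.continuous_timeDeriv
  have cφΔ : Continuous fun z : ℝ × (EuclideanSpace ℝ (Fin 3)) => (Δ (φ z.1)) z.2 := by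
    have h := ((hφ.isSmoothSpaceTimeOn univ).laplacian uniqueDiffOn_univ).continuousOn
    rw [univ_prod_univ, continuousOn_univ] at h
    exact h
  have cφi : ∀ v : (EuclideanSpace ℝ (Fin 3)), Continuous fun z : ℝ × (EuclideanSpace ℝ (Fin 3)) => fderiv ℝ (φ z.1) z.2 v := fun v =>
    continuous_fderiv_slice_of_contDiff hφ.contDiff v
  have cφij : ∀ v v' : (EuclideanSpace ℝ (Fin 3)), Continuous fun z : ℝ × (EuclideanSpace ℝ (Fin 3)) =>
      fderiv ℝ (fun y => fderiv ℝ (φ z.1) y v) z.2 v' := fun v v' =>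
    hφ.continuous_fderiv_fderiv_slice v v'
  have zφ : ∀ z : ℝ × (EuclideanSpace ℝ (Fin 3)), z ∉ K → φ z.1 z.2 = 0 := fun z hz =>
    show uncurry φ z = 0 from image_eq_zero_of_notMem_tsupport hz
  have zφt : ∀ z : ℝ × (EuclideanSpace ℝ (Fin 3)), z ∉ K → timeDeriv φ z.1 z.2 = 0 := fun z hz =>
    IsSpaceTimeTestOn.timeDeriv_eq_zero_of_notMem hz
  have zφΔ : ∀ z : ℝ × (EuclideanSpace ℝ (Fin 3)), z ∉ K → (Δ (φ z.1)) z.2 = 0 := fun z hz =>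
    laplacian_slice_eq_zero_of_notMem_tsupport hz
  have zφi : ∀ (v : (EuclideanSpace ℝ (Fin 3))) (z : ℝ × (EuclideanSpace ℝ (Fin 3))), z ∉ K → fderiv ℝ (φ z.1) z.2 v = 0 := fun v z hz => by
    rw [IsSpaceTimeTestOn.fderiv_slice_eq_zero_of_notMem hz]; rfl
  have zφij : ∀ (v v' : (EuclideanSpace ℝ (Fin 3))) (z : ℝ × (EuclideanSpace ℝ (Fin 3))), z ∉ K →
      fderiv ℝ (fun y => fderiv ℝ (φ z.1) y v) z.2 v' = 0 := fun v v' z hz =>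
    fderiv_fderiv_slice_eq_zero_of_notMem_tsupport hz v v'
  /- ### spatial localisation of the derivative cut-offs -/
  set A : Set (EuclideanSpace ℝ (Fin 3)) := {y | ρ / 2 ≤ ‖y - w.2‖} with hA_def
  have dφ0 : ∀ (t : ℝ) (y : (EuclideanSpace ℝ (Fin 3))), ‖y - w.2‖ < ρ / 2 → fderiv ℝ (φ t) y = 0 := fun t y hy =>
    fderiv_eq_zero_of_eventuallyEq_const (hφloc t y hy)
  have aφi : ∀ (v : (EuclideanSpace ℝ (Fin 3))) (z : ℝ × (EuclideanSpace ℝ (Fin 3))), fderiv ℝ (φ z.1) z.2 v ≠ 0 → z.2 ∈ A := by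
    intro v z hz
    by_contra h
    rw [hA_def, mem_setOf_eq, not_le] at h
    rw [dφ0 z.1 z.2 h, _root_.zero_apply] at hz
    exact hz rfl
  have aφΔ : ∀ z : ℝ × (EuclideanSpace ℝ (Fin 3)), (Δ (φ z.1)) z.2 ≠ 0 → z.2 ∈ A := by
    intro z hz
    by_contra h
    rw [hA_def, mem_setOf_eq, not_le] at h
    exact hz (laplacian_eq_zero_of_eventuallyEq_const (hφloc z.1 z.2 h))
  have aφij : ∀ (v v' : (EuclideanSpace ℝ (Fin 3))) (z : ℝ × (EuclideanSpace ℝ (Fin 3))),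
      fderiv ℝ (fun y => fderiv ℝ (φ z.1) y v) z.2 v' ≠ 0 → z.2 ∈ A := by
    intro v v' z hz
    by_contra h
    rw [hA_def, mem_setOf_eq, not_le] at h
    have h1 : ∀ᶠ y in 𝓝 z.2, ‖y - w.2‖ < ρ / 2 :=
      (isOpen_lt (continuous_id.sub continuous_const).norm continuous_const).mem_nhds h
    have h2 : (fun y => fderiv ℝ (φ z.1) y v) =ᶠ[𝓝 z.2] fun _ => (0 : ℝ) :=
      h1.mono fun y hy => by simp only [dφ0 z.1 y hy, _root_.zero_apply]
    exact hz (by rw [fderiv_eq_zero_of_eventuallyEq_const h2, _root_.zero_apply])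
  /- ### separation geometry -/
  set U : Set (ℝ × (EuclideanSpace ℝ (Fin 3))) := {z | ‖z.2 - w.2‖ < ρ / 4} with hU_def
  have hU : IsOpen U := isOpen_lt (continuous_snd.sub continuous_const).norm continuous_const
  set Ag : Set (EuclideanSpace ℝ (Fin 3)) := {y | ‖y - w.2‖ < ρ / 4} with hAg_def
  have hsep : ∀ a ∈ A, ∀ a' ∈ Ag, ρ / 4 ≤ ‖a - a'‖ := by
    intro a ha a' ha'
    rw [hA_def, mem_setOf_eq] at ha
    rw [hAg_def, mem_setOf_eq] at ha'
    have h := norm_sub_norm_le (a - w.2) (a' - w.2)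
    rw [sub_sub_sub_cancel_right] at h
    linarith
  have hsep0 : ∀ a ∈ (univ : Set (EuclideanSpace ℝ (Fin 3))), ∀ a' ∈ (univ : Set (EuclideanSpace ℝ (Fin 3))), (0 : ℝ) ≤ ‖a - a'‖ :=
    fun a _ a' _ => norm_nonneg _
  have hUA : ∀ z ∈ U, ∀ a ∈ A, ρ / 4 ≤ ‖z.2 - a‖ := by
    intro z hz a ha
    rw [hA_def, mem_setOf_eq] at ha
    rw [hU_def, mem_setOf_eq] at hz
    have h := norm_sub_norm_le (a - w.2) (z.2 - w.2)
    rw [sub_sub_sub_cancel_right, norm_sub_rev a z.2] at h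
    linarith
  have hUA0 : ∀ z ∈ U, ∀ a ∈ (univ : Set (EuclideanSpace ℝ (Fin 3))), (0 : ℝ) ≤ ‖z.2 - a‖ := fun z _ a _ => norm_nonneg _
  have hδ : (0 : ℝ) < ρ / 4 := by positivity
  /- ### the kernels -/
  have kG := isSliceBoundKernel_backKernel_heatKernel (E := (EuclideanSpace ℝ (Fin 3)))
  have kGoff := isOffDiagKernel_backKernel_heatKernel (E := (EuclideanSpace ℝ (Fin 3))) hδ
  have kdG := fun v : (EuclideanSpace ℝ (Fin 3)) => isSliceBoundKernel_backKernel_heatKernelGrad (E := (EuclideanSpace ℝ (Fin 3))) v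
  have kΞ := isSliceBoundKernel_backKernel_heatD1_newtonNear one_pos one_lt_two c
  have kΞoff := isOffDiagKernel_backKernel_heatD1_newtonNear one_pos one_lt_two hδ c
  have kdΞoff := fun v : (EuclideanSpace ℝ (Fin 3)) => isOffDiagKernel_backKernel_heatD2_newtonNear one_pos one_lt_two hδ v c
  have kL := (isOffDiagKernel_backKernel_heatD1_newtonFarLaplacian one_pos one_lt_two c).of_univ
    {y : (EuclideanSpace ℝ (Fin 3)) | (0 : ℝ) ≤ ‖y‖}
  have kddΞ := fun i j : Fin 3 =>
    exists_isSliceBoundKernel_backKernel_heatD3_newtonNear one_pos one_lt_two (he1 j) (he1 i) hc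
  /- ### the eleven potentials -/
  set WA1 : ℝ × (EuclideanSpace ℝ (Fin 3)) → ℝ := (fun v => backKernel (UnboundedOperators.heatKernel (E := (EuclideanSpace ℝ (Fin 3)))) (-v))
    ⋆[lsmul ℝ ℝ, (volume : Measure (ℝ × (EuclideanSpace ℝ (Fin 3))))]
      (fun z => (timeDeriv φ z.1 z.2 + (Δ (φ z.1)) z.2) * ⟪u z.1 z.2, c⟫) with hWA1
  set WA2 : Fin 3 → ℝ × (EuclideanSpace ℝ (Fin 3)) → ℝ := fun i => (fun v => backKernel (heatKernelGrad (e i)) (-v))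
    ⋆[lsmul ℝ ℝ, (volume : Measure (ℝ × (EuclideanSpace ℝ (Fin 3))))]
      (fun z => (2 * fderiv ℝ (φ z.1) z.2 (e i)) * ⟪u z.1 z.2, c⟫) with hWA2
  set WA3 : Fin 3 → ℝ × (EuclideanSpace ℝ (Fin 3)) → ℝ := fun i =>
    (fun v => backKernel (UnboundedOperators.heatKernel (E := (EuclideanSpace ℝ (Fin 3)))) (-v))
    ⋆[lsmul ℝ ℝ, (volume : Measure (ℝ × (EuclideanSpace ℝ (Fin 3))))]
      (fun z => fderiv ℝ (φ z.1) z.2 (e i) * (⟪u z.1 z.2, e i⟫ * ⟪u z.1 z.2, c⟫)) with hWA3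
  set WA4 : Fin 3 → ℝ × (EuclideanSpace ℝ (Fin 3)) → ℝ := fun i => (fun v => backKernel (heatKernelGrad (e i)) (-v))
    ⋆[lsmul ℝ ℝ, (volume : Measure (ℝ × (EuclideanSpace ℝ (Fin 3))))]
      (fun z => φ z.1 z.2 * (⟪u z.1 z.2, e i⟫ * ⟪u z.1 z.2, c⟫)) with hWA4
  set WA5 : ℝ × (EuclideanSpace ℝ (Fin 3)) → ℝ := (fun v => backKernel (UnboundedOperators.heatKernel (E := (EuclideanSpace ℝ (Fin 3)))) (-v))
    ⋆[lsmul ℝ ℝ, (volume : Measure (ℝ × (EuclideanSpace ℝ (Fin 3))))]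
      (fun z => fderiv ℝ (φ z.1) z.2 c * p z.1 z.2) with hWA5
  set WB1 : ℝ × (EuclideanSpace ℝ (Fin 3)) → ℝ :=
    (fun v => backKernel (fun a y => heatD1 a c (newtonFarLaplacian 1 2) y) (-v))
    ⋆[lsmul ℝ ℝ, (volume : Measure (ℝ × (EuclideanSpace ℝ (Fin 3))))]
      (fun z => φ z.1 z.2 * p z.1 z.2) with hWB1
  set WB2 : ℝ × (EuclideanSpace ℝ (Fin 3)) → ℝ :=
    (fun v => backKernel (fun a y => heatD1 a c (newtonNear 1 2) y) (-v))
    ⋆[lsmul ℝ ℝ, (volume : Measure (ℝ × (EuclideanSpace ℝ (Fin 3))))]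
      (fun z => (-(Δ (φ z.1)) z.2) * p z.1 z.2) with hWB2
  set WB3 : Fin 3 → ℝ × (EuclideanSpace ℝ (Fin 3)) → ℝ := fun i =>
    (fun v => backKernel (fun a y => heatD2 a (e i) c (newtonNear 1 2) y) (-v))
    ⋆[lsmul ℝ ℝ, (volume : Measure (ℝ × (EuclideanSpace ℝ (Fin 3))))]
      (fun z => (-(2 * fderiv ℝ (φ z.1) z.2 (e i))) * p z.1 z.2) with hWB3
  set WB4 : Fin 3 → Fin 3 → ℝ × (EuclideanSpace ℝ (Fin 3)) → ℝ := fun i j =>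
    (fun v => backKernel (fun a y => heatD3 a (e j) (e i) c (newtonNear 1 2) y) (-v))
    ⋆[lsmul ℝ ℝ, (volume : Measure (ℝ × (EuclideanSpace ℝ (Fin 3))))]
      (fun z => (-(φ z.1 z.2)) * (⟪u z.1 z.2, e i⟫ * ⟪u z.1 z.2, e j⟫)) with hWB4
  set WB5 : Fin 3 → Fin 3 → ℝ × (EuclideanSpace ℝ (Fin 3)) → ℝ := fun i j =>
    (fun v => backKernel (fun a y => heatD1 a c (newtonNear 1 2) y) (-v))
    ⋆[lsmul ℝ ℝ, (volume : Measure (ℝ × (EuclideanSpace ℝ (Fin 3))))]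
      (fun z => (-(fderiv ℝ (fun y => fderiv ℝ (φ z.1) y (e i)) z.2 (e j))) *
        (⟪u z.1 z.2, e i⟫ * ⟪u z.1 z.2, e j⟫)) with hWB5
  set WB6 : Fin 3 → Fin 3 → ℝ × (EuclideanSpace ℝ (Fin 3)) → ℝ := fun i j =>
    (fun v => backKernel (fun a y => heatD2 a (e i) c (newtonNear 1 2) y) (-v))
    ⋆[lsmul ℝ ℝ, (volume : Measure (ℝ × (EuclideanSpace ℝ (Fin 3))))]
      (fun z => (-(2 * fderiv ℝ (φ z.1) z.2 (e j))) * (⟪u z.1 z.2, e j⟫ * ⟪u z.1 z.2, e i⟫))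
    with hWB6
  /- ### continuity of the potentials -/
  have cA1 : Continuous WA1 :=
    continuous_potential_sliceBound kG hK hKQ hQm hQab (cφt.fun_add cφΔ)
      (fun z hz => by rw [zφt z hz, zφΔ z hz, add_zero]) (mu c) hM (bm1 c hc)
  have cA2 : ∀ i, Continuous (WA2 i) := fun i =>
    continuous_potential_sliceBound (kdG (e i)) hK hKQ hQm hQab (continuous_const.fun_mul (cφi (e i)))
      (fun z hz => by rw [zφi (e i) z hz, mul_zero]) (mu c) hM (bm1 c hc)
  have cA3 : ∀ i, Continuous (WA3 i) := fun i =>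
    continuous_potential_sliceBound kG hK hKQ hQm hQab (cφi (e i)) (zφi (e i)) (muu (e i) c) hM2
      (bm2 (e i) c (he1 i) hc)
  have cA4 : ∀ i, Continuous (WA4 i) := fun i =>
    continuous_potential_sliceBound (kdG (e i)) hK hKQ hQm hQab cφ zφ (muu (e i) c) hM2
      (bm2 (e i) c (he1 i) hc)
  have cA5 : ContinuousOn WA5 U :=
    continuousOn_potential_offDiag kGoff hK (cφi c) (zφi c) (aφi c) mp hU hUA
  have cB1 : ContinuousOn WB1 U :=
    continuousOn_potential_offDiag kL hK cφ zφ (A := univ) (fun _ _ => mem_univ _) mp hU hUA0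
  have cB2 : ContinuousOn WB2 U :=
    continuousOn_potential_offDiag kΞoff hK cφΔ.fun_neg (fun z hz => by rw [zφΔ z hz, neg_zero])
      (fun z hz => aφΔ z fun h => hz (by rw [h, neg_zero])) mp hU hUA
  have cB3 : ∀ i, ContinuousOn (WB3 i) U := fun i =>
    continuousOn_potential_offDiag (kdΞoff (e i)) hK (continuous_const.fun_mul (cφi (e i))).fun_neg
      (fun z hz => by rw [zφi (e i) z hz, mul_zero, neg_zero])
      (fun z hz => aφi (e i) z fun h => hz (by rw [h, mul_zero, neg_zero])) mp hU hUA
  have cB4 : ∀ i j, Continuous (WB4 i j) := fun i j => by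
    obtain ⟨C, -, hk⟩ := kddΞ i j
    exact continuous_potential_sliceBound hk hK hKQ hQm hQab cφ.fun_neg
      (fun z hz => by rw [zφ z hz, neg_zero]) (muu (e i) (e j)) hM2 (bm2 (e i) (e j) (he1 i) (he1 j))
  have cB5 : ∀ i j, Continuous (WB5 i j) := fun i j =>
    continuous_potential_sliceBound kΞ hK hKQ hQm hQab (cφij (e i) (e j)).fun_neg
      (fun z hz => by rw [zφij (e i) (e j) z hz, neg_zero]) (muu (e i) (e j)) hM2
      (bm2 (e i) (e j) (he1 i) (he1 j))
  have cB6 : ∀ i j, ContinuousOn (WB6 i j) U := fun i j =>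
    continuousOn_potential_offDiag (kdΞoff (e i)) hK (continuous_const.fun_mul (cφi (e j))).fun_neg
      (fun z hz => by rw [zφi (e j) z hz, mul_zero, neg_zero])
      (fun z hz => aφi (e j) z fun h => hz (by rw [h, mul_zero, neg_zero])) (muu (e j) (e i)) hU hUA
  /- ### the representative -/
  refine ⟨fun z => WA1 z + (∑ i, WA2 i z) + (∑ i, WA3 i z) + (∑ i, WA4 i z) + WA5 z + WB1 z + WB2 z
      + (∑ i, WB3 i z) + (∑ i, ∑ j, WB4 i j z) + (∑ i, ∑ j, WB5 i j z) + (∑ i, ∑ j, WB6 i j z),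
    ?_, ?_⟩
  · -- continuity on `U`
    have s1 : ContinuousOn (fun z => WA1 z + ∑ i, WA2 i z) U :=
      cA1.continuousOn.add (continuousOn_finsetSum Finset.univ fun i _ => (cA2 i).continuousOn)
    have s2 := s1.add (continuousOn_finsetSum Finset.univ fun i _ => ((cA3 i).continuousOn (s := U)))
    have s3 := s2.add (continuousOn_finsetSum Finset.univ fun i _ => ((cA4 i).continuousOn (s := U)))
    have s4 := s3.add cA5
    have s5 := s4.add cB1
    have s6 := s5.add cB2
    have s7 := s6.add (continuousOn_finsetSum Finset.univ fun i _ => cB3 i)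
    have s8 := s7.add (continuousOn_finsetSum Finset.univ fun i _ =>
      continuousOn_finsetSum Finset.univ fun j _ => ((cB4 i j).continuousOn (s := U)))
    have s9 := s8.add (continuousOn_finsetSum Finset.univ fun i _ =>
      continuousOn_finsetSum Finset.univ fun j _ => ((cB5 i j).continuousOn (s := U)))
    exact s9.add (continuousOn_finsetSum Finset.univ fun i _ => continuousOn_finsetSum Finset.univ fun j _ => cB6 i j)
  /- ### the identity for a test function supported in `Q*_{ρ/4}(w)` -/
  intro g hgs hgc hgV
  set gc : ℝ → (EuclideanSpace ℝ (Fin 3)) → ℝ := fun t x => g (t, x) with hgc_def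
  have hg : IsSpaceTimeTestOn (⊤ : Opens (ℝ × (EuclideanSpace ℝ (Fin 3)))) gc := ⟨hgs, hgc, by simp⟩
  have hVQ : parabolicCylinderCentered (ρ / 4) w ⊆ parabolicCylinderCentered ρ w :=
    parabolicCylinderCentered_mono (by positivity) (by linarith) w
  have hVU : parabolicCylinderCentered (ρ / 4) w ⊆ U := fun z hz => by
    rw [mem_parabolicCylinderCentered, dist_eq_norm] at hz
    exact hz.2
  have hgU : tsupport g ⊆ U := hgV.trans hVU
  have hgA : ∀ z : ℝ × (EuclideanSpace ℝ (Fin 3)), g z ≠ 0 → z.2 ∈ Ag := fun z hz => by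
    have h := hgV (subset_tsupport _ hz)
    rw [mem_parabolicCylinderCentered, dist_eq_norm] at h
    exact h.2
  have hgA' : ∀ (t : ℝ) (y : (EuclideanSpace ℝ (Fin 3))), gc t y ≠ 0 → y ∈ Ag := fun t y h => hgA (t, y) h
  -- the master identity
  have hmain := integral_cutoff_mul_test_mul_inner_eq (η := heatDuhamelBack 1 gc)
    (Ξ := heatDuhamelBack 1 fun t y => fderiv ℝ (newtonNearPotential 1 2 (gc t)) y c)
    (L := heatDuhamelBack 1 fun t y => newtonFarSmoothing 1 2 (fun y' => fderiv ℝ (gc t) y' c) y)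
    hsol hφ hg one_pos one_lt_two e rfl rfl rfl
  simp only [coe_parabolicCylinderCenteredOpens] at hmain
  -- the left-hand side
  have hLHS : ∫ z in parabolicCylinderCentered ρ w, φ z.1 z.2 * gc z.1 z.2 * ⟪u z.1 z.2, c⟫ = ∫ z, g z * ⟪u z.1 z.2, c⟫ := by
    rw [setIntegral_eq_integral_of_forall_compl_eq_zero fun z hz => ?_]
    · refine integral_congr_ae (Eventually.of_forall fun z => ?_)
      by_cases hz : g z = 0
      · simp only [hgc_def, hz, mul_zero, zero_mul]
      · have hzV := hgV (subset_tsupport _ hz)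
        rw [mem_parabolicCylinderCentered, dist_eq_norm] at hzV
        have ht : |z.1 - w.1| ≤ ρ ^ 2 / 4 := by
          rw [abs_le]; constructor <;> nlinarith [hzV.1.1, hzV.1.2, sq_nonneg ρ]
        simp only [hgc_def, Prod.mk.eta]
        rw [hφ1 z ht (by linarith [hzV.2]), one_mul]
    · have h0 : g z = 0 := image_eq_zero_of_notMem_tsupport fun h => hz (hVQ (hgV h))
      simp only [hgc_def, h0, mul_zero, zero_mul]
  -- the eleven terms
  have eA1 : ∫ z in parabolicCylinderCentered ρ w, (timeDeriv φ z.1 z.2 + (Δ (φ z.1)) z.2) * ⟪u z.1 z.2, c⟫ *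
      heatDuhamelBack 1 gc z.1 z.2 = ∫ z, g z * WA1 z :=
    setIntegral_eq_integral_mul_potential_sliceBound kG hg hK hKQ hQm hQab
      (X := fun z => heatDuhamelBack 1 gc z.1 z.2) (cφt.fun_add cφΔ)
      (fun z hz => by rw [zφt z hz, zφΔ z hz, add_zero]) (mu c) hM (bm1 c hc)
      fun z _ => heatDuhamelBack_one_eq_convolution_heatKernel hg z.1 z.2
  have eA2 : ∀ i, ∫ z in parabolicCylinderCentered ρ w, (2 * fderiv ℝ (φ z.1) z.2 (e i)) * ⟪u z.1 z.2, c⟫ *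
      fderiv ℝ (heatDuhamelBack 1 gc z.1) z.2 (e i) = ∫ z, g z * WA2 i z := fun i =>
    setIntegral_eq_integral_mul_potential_sliceBound (kdG (e i)) hg hK hKQ hQm hQab
      (X := fun z => fderiv ℝ (heatDuhamelBack 1 gc z.1) z.2 (e i))
      (continuous_const.fun_mul (cφi (e i))) (fun z hz => by rw [zφi (e i) z hz, mul_zero]) (mu c) hM
      (bm1 c hc) fun z _ => fderiv_heatDuhamelBack_one_eq_convolution_heatKernelGrad hg z.1 z.2 (e i)
  have eA3 : ∀ i, ∫ z in parabolicCylinderCentered ρ w, fderiv ℝ (φ z.1) z.2 (e i) * (⟪u z.1 z.2, e i⟫ * ⟪u z.1 z.2, c⟫) *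
      heatDuhamelBack 1 gc z.1 z.2 = ∫ z, g z * WA3 i z := fun i =>
    setIntegral_eq_integral_mul_potential_sliceBound kG hg hK hKQ hQm hQab
      (X := fun z => heatDuhamelBack 1 gc z.1 z.2) (cφi (e i)) (zφi (e i)) (muu (e i) c) hM2
      (bm2 (e i) c (he1 i) hc) fun z _ => heatDuhamelBack_one_eq_convolution_heatKernel hg z.1 z.2
  have eA4 : ∀ i, ∫ z in parabolicCylinderCentered ρ w, φ z.1 z.2 * (⟪u z.1 z.2, e i⟫ * ⟪u z.1 z.2, c⟫) *
      fderiv ℝ (heatDuhamelBack 1 gc z.1) z.2 (e i) = ∫ z, g z * WA4 i z := fun i =>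
    setIntegral_eq_integral_mul_potential_sliceBound (kdG (e i)) hg hK hKQ hQm hQab
      (X := fun z => fderiv ℝ (heatDuhamelBack 1 gc z.1) z.2 (e i)) cφ zφ (muu (e i) c) hM2
      (bm2 (e i) c (he1 i) hc)
      fun z _ => fderiv_heatDuhamelBack_one_eq_convolution_heatKernelGrad hg z.1 z.2 (e i)
  have eA5 : ∫ z in parabolicCylinderCentered ρ w, fderiv ℝ (φ z.1) z.2 c * p z.1 z.2 * heatDuhamelBack 1 gc z.1 z.2 =
      ∫ z, g z * WA5 z :=
    setIntegral_eq_integral_mul_potential_offDiag kGoff hg hgA hsep hK hKQ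
      (X := fun z => heatDuhamelBack 1 gc z.1 z.2) (cφi c) (zφi c) (aφi c) mp
      fun z _ _ => heatDuhamelBack_one_eq_convolution_heatKernel hg z.1 z.2
  have eB1 : ∫ z in parabolicCylinderCentered ρ w, φ z.1 z.2 * p z.1 z.2 *
      heatDuhamelBack 1 (fun t y => newtonFarSmoothing 1 2 (fun y' => fderiv ℝ (gc t) y' c) y)
        z.1 z.2 = ∫ z, g z * WB1 z :=
    setIntegral_eq_integral_mul_potential_offDiag kL hg (Ag := univ) (fun _ _ => mem_univ _) hsep0
      hK hKQ (X := fun z => heatDuhamelBack 1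
        (fun t y => newtonFarSmoothing 1 2 (fun y' => fderiv ℝ (gc t) y' c) y) z.1 z.2)
      cφ zφ (A := univ) (fun _ _ => mem_univ _) mp
      fun z _ _ => heatDuhamelBack_newtonFarSmoothing_fderiv_eq_convolution hg one_pos one_lt_two
        c z.1 z.2
  have eB2 : ∫ z in parabolicCylinderCentered ρ w, (-(Δ (φ z.1)) z.2) * p z.1 z.2 *
      heatDuhamelBack 1 (fun t y => fderiv ℝ (newtonNearPotential 1 2 (gc t)) y c) z.1 z.2 =
      ∫ z, g z * WB2 z :=
    setIntegral_eq_integral_mul_potential_offDiag kΞoff hg hgA hsep hK hKQ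
      (X := fun z => heatDuhamelBack 1
        (fun t y => fderiv ℝ (newtonNearPotential 1 2 (gc t)) y c) z.1 z.2)
      cφΔ.fun_neg (fun z hz => by rw [zφΔ z hz, neg_zero])
      (fun z hz => aφΔ z fun h => hz (by rw [h, neg_zero])) mp
      fun z _ _ => heatDuhamelBack_fderiv_newtonNearPotential_eq_convolution hg one_pos one_lt_two
        c z.1 z.2
  have eB3 : ∀ i, ∫ z in parabolicCylinderCentered ρ w, (-(2 * fderiv ℝ (φ z.1) z.2 (e i))) * p z.1 z.2 *
      fderiv ℝ (heatDuhamelBack 1 (fun t y => fderiv ℝ (newtonNearPotential 1 2 (gc t)) y c) z.1)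
        z.2 (e i) = ∫ z, g z * WB3 i z := fun i =>
    setIntegral_eq_integral_mul_potential_offDiag (kdΞoff (e i)) hg hgA hsep hK hKQ
      (X := fun z => fderiv ℝ (heatDuhamelBack 1
        (fun t y => fderiv ℝ (newtonNearPotential 1 2 (gc t)) y c) z.1) z.2 (e i))
      (continuous_const.fun_mul (cφi (e i))).fun_neg (fun z hz => by rw [zφi (e i) z hz, mul_zero, neg_zero])
      (fun z hz => aφi (e i) z fun h => hz (by rw [h, mul_zero, neg_zero])) mp
      fun z _ hz => fderiv_heatDuhamelBack_fderiv_newtonNearPotential_eq_convolution hg one_pos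
        one_lt_two (e i) c hδ hgA' z.1 z.2 hz
  have eB4 : ∀ i j, ∫ z in parabolicCylinderCentered ρ w, (-(φ z.1 z.2)) * (⟪u z.1 z.2, e i⟫ * ⟪u z.1 z.2, e j⟫) *
      fderiv ℝ (fun y => fderiv ℝ (heatDuhamelBack 1
        (fun t y => fderiv ℝ (newtonNearPotential 1 2 (gc t)) y c) z.1) y (e i)) z.2 (e j) =
      ∫ z, g z * WB4 i j z := fun i j => by
    obtain ⟨C, -, hk⟩ := kddΞ i j
    exact setIntegral_eq_integral_mul_potential_sliceBound hk hg hK hKQ hQm hQab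
      (X := fun z => fderiv ℝ (fun y => fderiv ℝ (heatDuhamelBack 1
        (fun t y => fderiv ℝ (newtonNearPotential 1 2 (gc t)) y c) z.1) y (e i)) z.2 (e j))
      cφ.fun_neg (fun z hz => by rw [zφ z hz, neg_zero]) (muu (e i) (e j)) hM2
      (bm2 (e i) (e j) (he1 i) (he1 j))
      fun z _ => fderiv_fderiv_heatDuhamelBack_fderiv_newtonNearPotential_eq_convolution hg one_pos
        one_lt_two (he1 j) (he1 i) hc z.1 z.2
  have eB5 : ∀ i j, ∫ z in parabolicCylinderCentered ρ w, (-(fderiv ℝ (fun y => fderiv ℝ (φ z.1) y (e i)) z.2 (e j))) *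
      (⟪u z.1 z.2, e i⟫ * ⟪u z.1 z.2, e j⟫) *
      heatDuhamelBack 1 (fun t y => fderiv ℝ (newtonNearPotential 1 2 (gc t)) y c) z.1 z.2 =
      ∫ z, g z * WB5 i j z := fun i j =>
    setIntegral_eq_integral_mul_potential_sliceBound kΞ hg hK hKQ hQm hQab
      (X := fun z => heatDuhamelBack 1
        (fun t y => fderiv ℝ (newtonNearPotential 1 2 (gc t)) y c) z.1 z.2)
      (cφij (e i) (e j)).fun_neg (fun z hz => by rw [zφij (e i) (e j) z hz, neg_zero]) (muu (e i) (e j))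
      hM2 (bm2 (e i) (e j) (he1 i) (he1 j))
      fun z _ => heatDuhamelBack_fderiv_newtonNearPotential_eq_convolution hg one_pos one_lt_two
        c z.1 z.2
  have eB6 : ∀ i j, ∫ z in parabolicCylinderCentered ρ w, (-(2 * fderiv ℝ (φ z.1) z.2 (e j))) *
      (⟪u z.1 z.2, e j⟫ * ⟪u z.1 z.2, e i⟫) *
      fderiv ℝ (heatDuhamelBack 1 (fun t y => fderiv ℝ (newtonNearPotential 1 2 (gc t)) y c) z.1)
        z.2 (e i) = ∫ z, g z * WB6 i j z := fun i j =>
    setIntegral_eq_integral_mul_potential_offDiag (kdΞoff (e i)) hg hgA hsep hK hKQ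
      (X := fun z => fderiv ℝ (heatDuhamelBack 1
        (fun t y => fderiv ℝ (newtonNearPotential 1 2 (gc t)) y c) z.1) z.2 (e i))
      (continuous_const.fun_mul (cφi (e j))).fun_neg (fun z hz => by rw [zφi (e j) z hz, mul_zero, neg_zero])
      (fun z hz => aφi (e j) z fun h => hz (by rw [h, mul_zero, neg_zero])) (muu (e j) (e i))
      fun z _ hz => fderiv_heatDuhamelBack_fderiv_newtonNearPotential_eq_convolution hg one_pos
        one_lt_two (e i) c hδ hgA' z.1 z.2 hz
  -- integrability of `g · W_k`
  have ig : ∀ {W' : ℝ × (EuclideanSpace ℝ (Fin 3)) → ℝ}, ContinuousOn W' U → Integrable (fun z => g z * W' z) volume :=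
    fun hW' => integrable_test_mul_of_continuousOn hgs.continuous hgc hgU hU hW'
  have iA1 := ig cA1.continuousOn
  have iA2 := fun i => ig (cA2 i).continuousOn
  have iA3 := fun i => ig (cA3 i).continuousOn
  have iA4 := fun i => ig (cA4 i).continuousOn
  have iA5 := ig cA5
  have iB1 := ig cB1
  have iB2 := ig cB2
  have iB3 := fun i => ig (cB3 i)
  have iB4 := fun i j => ig (cB4 i j).continuousOn
  have iB5 := fun i j => ig (cB5 i j).continuousOn
  have iB6 := fun i j => ig (cB6 i j)
  have iA2s : Integrable (fun z => ∑ i, g z * WA2 i z) volume := integrable_finsetSum _ fun i _ => iA2 i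
  have iA3s : Integrable (fun z => ∑ i, g z * WA3 i z) volume := integrable_finsetSum _ fun i _ => iA3 i
  have iA4s : Integrable (fun z => ∑ i, g z * WA4 i z) volume := integrable_finsetSum _ fun i _ => iA4 i
  have iB3s : Integrable (fun z => ∑ i, g z * WB3 i z) volume := integrable_finsetSum _ fun i _ => iB3 i
  have iB4s : Integrable (fun z => ∑ i, ∑ j, g z * WB4 i j z) volume :=
    integrable_finsetSum _ fun i _ => integrable_finsetSum _ fun j _ => iB4 i j
  have iB5s : Integrable (fun z => ∑ i, ∑ j, g z * WB5 i j z) volume :=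
    integrable_finsetSum _ fun i _ => integrable_finsetSum _ fun j _ => iB5 i j
  have iB6s : Integrable (fun z => ∑ i, ∑ j, g z * WB6 i j z) volume :=
    integrable_finsetSum _ fun i _ => integrable_finsetSum _ fun j _ => iB6 i j
  -- split `∫ g W`
  have hW : ∫ z, g z * (WA1 z + (∑ i, WA2 i z) + (∑ i, WA3 i z) + (∑ i, WA4 i z) + WA5 z + WB1 z
      + WB2 z + (∑ i, WB3 i z) + (∑ i, ∑ j, WB4 i j z) + (∑ i, ∑ j, WB5 i j z)
      + (∑ i, ∑ j, WB6 i j z)) =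
      (∫ z, g z * WA1 z) + (∑ i, ∫ z, g z * WA2 i z) + (∑ i, ∫ z, g z * WA3 i z)
      + (∑ i, ∫ z, g z * WA4 i z) + (∫ z, g z * WA5 z) + (∫ z, g z * WB1 z) + (∫ z, g z * WB2 z)
      + (∑ i, ∫ z, g z * WB3 i z) + (∑ i, ∑ j, ∫ z, g z * WB4 i j z)
      + (∑ i, ∑ j, ∫ z, g z * WB5 i j z) + (∑ i, ∑ j, ∫ z, g z * WB6 i j z) := by
    simp only [mul_add, Finset.mul_sum]
    have h1 := iA1.fun_add iA2s
    have h2 := h1.fun_add iA3s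
    have h3 := h2.fun_add iA4s
    have h4 := h3.fun_add iA5
    have h5 := h4.fun_add iB1
    have h6 := h5.fun_add iB2
    have h7 := h6.fun_add iB3s
    have h8 := h7.fun_add iB4s
    have h9 := h8.fun_add iB5s
    rw [integral_add h9 iB6s, integral_add h8 iB5s, integral_add h7 iB4s, integral_add h6 iB3s,
      integral_add h5 iB2, integral_add h4 iB1, integral_add h3 iA5, integral_add h2 iA4s,
      integral_add h1 iA3s, integral_add iA1 iA2s,
      integral_finsetSum _ (fun i _ => iA2 i), integral_finsetSum _ (fun i _ => iA3 i),
      integral_finsetSum _ (fun i _ => iA4 i), integral_finsetSum _ (fun i _ => iB3 i),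
      integral_finsetSum _ (fun i _ => integrable_finsetSum _ fun j _ => iB4 i j),
      integral_finsetSum _ (fun i _ => integrable_finsetSum _ fun j _ => iB5 i j),
      integral_finsetSum _ (fun i _ => integrable_finsetSum _ fun j _ => iB6 i j),
      Finset.sum_congr rfl fun i _ => integral_finsetSum _ (fun j _ => iB4 i j),
      Finset.sum_congr rfl fun i _ => integral_finsetSum _ (fun j _ => iB5 i j),
      Finset.sum_congr rfl fun i _ => integral_finsetSum _ (fun j _ => iB6 i j)]
  rw [hW, ← hLHS, hmain]
  simp only [eA1, eA2, eA3, eA4, eA5, eB1, eB2, eB3, eB4, eB5, eB6]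

end Local

/-! ### The theorem -/

/-- **Interior continuity of essentially bounded distributional solutions** (Seregin–Šverák
2009, §2, arXiv p. 8): discharge of the named fact `NSBoundedInteriorContinuity`. Around each
point of the cylinder the local duality representation
(`exists_continuousOn_forall_integral_mul_inner_eq`) and du Bois-Reymond's lemma identify each
component `⟪u, eₗ⟫` a.e. with a continuous function on `Q*_{ρ/4}(w)`; the local representatives
are glued by `exists_continuousOn_ae_eq_of_locally`. [cite: SereginSverak2009, §2 p. 8 (regularity inside Q₁ under (b8)–(b10))] -/
theorem NSBoundedInteriorContinuity_holds : NSBoundedInteriorContinuity := by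
  intro u p z R M hsol hbd _
  refine exists_continuousOn_ae_eq_of_locally (μ := volume) fun w hw => ?_
  obtain ⟨ρ, hρ, -, hρQ⟩ :=
    exists_parabolicCylinderCentered_subset (isOpen_parabolicCylinder R z) hw
  have hle : parabolicCylinderCenteredOpens ρ w ≤ parabolicCylinderOpens R z := hρQ
  have hsol₁ := hsol.of_le hle
  have hbd₁ : ∀ᵐ y ∂(volume.restrict (parabolicCylinderCentered ρ w)), ‖u y.1 y.2‖ ≤ max M 0 :=
    (ae_restrict_of_ae_restrict_of_subset hρQ hbd).mono fun y hy => hy.trans (le_max_left _ _)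
  set e : OrthonormalBasis (Fin 3) ℝ (EuclideanSpace ℝ (Fin 3)) := EuclideanSpace.basisFun (Fin 3) ℝ with he_def
  have he1 : ∀ i, ‖e i‖ ≤ 1 := fun i => (e.orthonormal.1 i).le
  choose W hWc hWi using fun i =>
    exists_continuousOn_forall_integral_mul_inner_eq hρ hsol₁ (le_max_right _ _) hbd₁ (he1 i)
  set V : Set (ℝ × (EuclideanSpace ℝ (Fin 3))) := parabolicCylinderCentered (ρ / 4) w with hV_def
  have hV : IsOpen V := isOpen_parabolicCylinderCentered _ _
  have hVQ : V ⊆ parabolicCylinderCentered ρ w :=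
    parabolicCylinderCentered_mono (by positivity) (by linarith) w
  have hVU : V ⊆ {y : ℝ × (EuclideanSpace ℝ (Fin 3)) | ‖y.2 - w.2‖ < ρ / 4} := fun y hy => by
    rw [hV_def, mem_parabolicCylinderCentered, dist_eq_norm] at hy
    exact hy.2
  refine ⟨V, hV, mem_parabolicCylinderCentered_self (by positivity) w, hVQ.trans hρQ,
    fun y => ∑ i, W i y • e i, ?_, ?_⟩
  · exact continuousOn_finsetSum Finset.univ fun i _ => ((hWc i).mono hVU).smul continuousOn_const
  · -- a.e. equality on `V`, componentwise by du Bois-Reymond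
    have hu := hsol₁.1
    have key : ∀ i, ∀ᵐ y ∂(volume : Measure (ℝ × (EuclideanSpace ℝ (Fin 3)))), y ∈ V → ⟪u y.1 y.2, e i⟫ = W i y := by
      intro i
      have hf : LocallyIntegrableOn (fun y : ℝ × (EuclideanSpace ℝ (Fin 3)) => ⟪u y.1 y.2, e i⟫ - W i y) V volume := by
        refine (locallyIntegrableOn_iff hV.isLocallyClosed).2 fun k hk hkc => ?_
        have hkQ : k ⊆ ((parabolicCylinderCenteredOpens ρ w : Opens (ℝ × (EuclideanSpace ℝ (Fin 3)))) : Set (ℝ × (EuclideanSpace ℝ (Fin 3)))) :=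
          hk.trans hVQ
        exact (integrableOn_inner_of_locallyIntegrableOn hkc hkQ hu (e i)).sub
          (((hWc i).mono (hk.trans hVU)).integrableOn_compact hkc)
      have h0 := hV.ae_eq_zero_of_integral_contDiff_smul_eq_zero hf fun g hg hgc hgV => by
        have i1 : Integrable (fun y : ℝ × (EuclideanSpace ℝ (Fin 3)) => g y * ⟪u y.1 y.2, e i⟫) volume :=
          integrable_test_mul (K := tsupport g) hgc hg.continuous
            (fun y hy => image_eq_zero_of_notMem_tsupport hy)
            (integrableOn_inner_of_locallyIntegrableOn hgc
              (hgV.trans hVQ : tsupport g ⊆ ((parabolicCylinderCenteredOpens ρ w :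
                Opens (ℝ × (EuclideanSpace ℝ (Fin 3)))) : Set (ℝ × (EuclideanSpace ℝ (Fin 3))))) hu (e i))
        have i2 : Integrable (fun y : ℝ × (EuclideanSpace ℝ (Fin 3)) => g y * W i y) volume :=
          integrable_test_mul_of_continuousOn hg.continuous hgc (hgV.trans hVU)
            (isOpen_lt (continuous_snd.sub continuous_const).norm continuous_const) (hWc i)
        simp only [smul_eq_mul, mul_sub]
        rw [integral_sub i1 i2, hWi i g hg hgc hgV, sub_self]
      filter_upwards [h0] with y hy hyV
      exact sub_eq_zero.1 (hy hyV)
    have key' : ∀ᵐ y ∂(volume : Measure (ℝ × (EuclideanSpace ℝ (Fin 3)))), ∀ i, y ∈ V → ⟪u y.1 y.2, e i⟫ = W i y :=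
      ae_all_iff.2 key
    rw [EventuallyEq, ae_restrict_iff' hV.measurableSet]
    filter_upwards [key'] with y hy hyV
    show u y.1 y.2 = ∑ i, W i y • e i
    calc u y.1 y.2 = ∑ i, ⟪e i, u y.1 y.2⟫ • e i := (e.sum_repr' _).symm
      _ = ∑ i, W i y • e i := Finset.sum_congr rfl fun i _ => by rw [real_inner_comm, hy i hyV]

end Literature.Analysis.FluidPDE
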